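import Mathlib
import Literature.NumberTheory.LFunctions.WeilMarkovQuadratic
import HarnessLib

/-!
# Increments of a windowed profile `f = 1_{[-b,b]} · p`

Stub `stub_incrementSplit` (INC) for the line *parity–multiplicity–commutator* of the crux
`GroundStateSimpleEven` (Weil ground state): the Rayleigh–Ritz trial functions of the line are
`f = 1_{[-b,b]} · p` with `p` a continuous (polynomial) profile, and the increment form
`D_t(f) = weilIncrement f t = ∫ |f(x+t) − f(x)|² dx` of the Markov part of Weil's functional must be
reduced to interval integrals of `p`.

Route: expand `|f(x+t) − f(x)|² = f(x+t)² + f(x)² − 2 f(x+t) f(x)`; the first two terms integrate to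
`‖f‖₂² = ∫_{-b}^{b} p²` each (translation invariance), and for `t ≥ 0` the cross term is
`1_{[-b, b-t]}(x) p(x+t) p(x)`, whose integral is `∫_{-b}^{b-t} p(x+t) p(x) dx` for `t ≤ 2b` and `0`
for `t ≥ 2b`. For `0 ≤ t ≤ 2b` the closed form
`D_t(f) = ∫_{-b}^{-b+t} p² + ∫_{b-t}^{b} p² + ∫_{-b}^{b-t} (p(x+t) − p(x))²`
then follows from interval additivity and the substitution `y = x + t`.
-/

open Set MeasureTheory Filter

open scoped Real Topology

open Literature.NumberTheory.LFunctions

namespace Summit.RiemannHypothesis.RiemannHypothesis.Theorems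

namespace GroundStateSimpleEven

set_option linter.dupNamespace false in
/-- `|u − v|² = u² + v² − 2uv` for real `u, v` viewed in `ℂ`. [folklore] -/
theorem incs_norm_sub_sq (u v : ℝ) : ‖(u : ℂ) - (v : ℂ)‖ ^ 2 = u ^ 2 + v ^ 2 - 2 * (u * v) := by
  rw [← Complex.ofReal_sub, Complex.norm_real, Real.norm_eq_abs, sq_abs]
  ring

set_option linter.dupNamespace false in
/-- The square of a windowed profile is the windowed square. [folklore] -/
theorem incs_indicator_sq (s : Set ℝ) (p : ℝ → ℝ) (x : ℝ) :
    s.indicator p x ^ 2 = s.indicator (fun y ↦ p y ^ 2) x := by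
  by_cases hx : x ∈ s
  · rw [indicator_of_mem hx, indicator_of_mem hx]
  · rw [indicator_of_notMem hx, indicator_of_notMem hx, zero_pow two_ne_zero]

set_option linter.dupNamespace false in
/-- The cross term: for `t ≥ 0`, `f(x+t) f(x) = 1_{[-b, b-t]}(x) · p(x+t) p(x)`. [folklore] -/
theorem incs_indicator_mul (p : ℝ → ℝ) (b : ℝ) {t : ℝ} (ht : 0 ≤ t) (x : ℝ) :
    (Icc (-b) b).indicator p (x + t) * (Icc (-b) b).indicator p x =
      (Icc (-b) (b - t)).indicator (fun y ↦ p (y + t) * p y) x := by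
  by_cases hx : x ∈ Icc (-b) (b - t)
  · have h1 : x + t ∈ Icc (-b) b := ⟨by linarith [hx.1], by linarith [hx.2]⟩
    have h2 : x ∈ Icc (-b) b := ⟨hx.1, by linarith [hx.2]⟩
    rw [indicator_of_mem hx, indicator_of_mem h1, indicator_of_mem h2]
  · rw [indicator_of_notMem hx]
    by_cases h2 : x ∈ Icc (-b) b
    · have h1 : x + t ∉ Icc (-b) b := fun h ↦ hx ⟨h2.1, by linarith [h.2]⟩
      rw [indicator_of_notMem h1, zero_mul]
    · rw [indicator_of_notMem h2, mul_zero]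

set_option linter.dupNamespace false in
/-- `f² = 1_{[-b,b]} p²` is integrable. [folklore] -/
theorem incs_integrable_sq {p : ℝ → ℝ} (hp : Continuous p) (b : ℝ) :
    Integrable fun x : ℝ ↦ (Icc (-b) b).indicator p x ^ 2 := by
  simp_rw [incs_indicator_sq]
  have hc : Continuous fun y : ℝ ↦ p y ^ 2 := by fun_prop
  exact hc.continuousOn.integrableOn_Icc.integrable_indicator measurableSet_Icc

set_option linter.dupNamespace false in
/-- The cross term `1_{[-b, b-t]} p(·+t) p` is integrable. [folklore] -/
theorem incs_integrable_mul {p : ℝ → ℝ} (hp : Continuous p) (b t : ℝ) :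
    Integrable fun x : ℝ ↦ (Icc (-b) (b - t)).indicator (fun y ↦ p (y + t) * p y) x := by
  have hc : Continuous fun y : ℝ ↦ p (y + t) * p y := by fun_prop
  exact hc.continuousOn.integrableOn_Icc.integrable_indicator measurableSet_Icc

set_option linter.dupNamespace false in
/-- `∫ f² = ∫_{-b}^{b} p²`. [folklore] -/
theorem incs_integral_sq (p : ℝ → ℝ) {b : ℝ} (hb : 0 < b) :
    ∫ x : ℝ, (Icc (-b) b).indicator p x ^ 2 = ∫ x in (-b)..b, p x ^ 2 := by
  simp_rw [incs_indicator_sq]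
  rw [integral_indicator measurableSet_Icc, integral_Icc_eq_integral_Ioc,
    intervalIntegral.integral_of_le (by linarith)]

set_option linter.dupNamespace false in
/-- The cross integral for `t ≤ 2b`: `∫ 1_{[-b,b-t]} p(·+t) p = ∫_{-b}^{b-t} p(x+t) p(x) dx`. [folklore] -/
theorem incs_integral_mul_of_le (p : ℝ → ℝ) {b t : ℝ} (ht : t ≤ 2 * b) :
    ∫ x : ℝ, (Icc (-b) (b - t)).indicator (fun y ↦ p (y + t) * p y) x =
      ∫ x in (-b)..(b - t), p (x + t) * p x := by
  rw [integral_indicator measurableSet_Icc, integral_Icc_eq_integral_Ioc,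
    intervalIntegral.integral_of_le (by linarith)]

set_option linter.dupNamespace false in
/-- The cross integral vanishes for `t ≥ 2b` (the supports meet in at most one point). [folklore] -/
theorem incs_integral_mul_of_ge (p : ℝ → ℝ) {b t : ℝ} (ht : 2 * b ≤ t) :
    ∫ x : ℝ, (Icc (-b) (b - t)).indicator (fun y ↦ p (y + t) * p y) x = 0 := by
  rw [integral_indicator measurableSet_Icc, integral_Icc_eq_integral_Ioc,
    Set.Ioc_eq_empty_of_le (by linarith), Measure.restrict_empty, integral_zero_measure]

set_option linter.dupNamespace false in
/-- **The increment form of a windowed profile through the cross term**: for `t ≥ 0`,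
`D_t(1_{[-b,b]} p) = 2 ∫_{-b}^{b} p² − 2 ∫ 1_{[-b,b-t]}(x) p(x+t) p(x) dx`. [folklore] -/
theorem incs_weilIncrement_eq {p : ℝ → ℝ} (hp : Continuous p) {b t : ℝ} (hb : 0 < b) (ht : 0 ≤ t) :
    weilIncrement (fun x : ℝ ↦ (((Icc (-b) b).indicator p x : ℝ) : ℂ)) t =
      2 * (∫ x in (-b)..b, p x ^ 2) -
        2 * ∫ x : ℝ, (Icc (-b) (b - t)).indicator (fun y ↦ p (y + t) * p y) x := by
  unfold weilIncrement
  simp only [incs_norm_sub_sq, incs_indicator_mul p b ht]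
  have i2 : Integrable fun x : ℝ ↦ (Icc (-b) b).indicator p x ^ 2 := incs_integrable_sq hp b
  have i1 : Integrable fun x : ℝ ↦ (Icc (-b) b).indicator p (x + t) ^ 2 := i2.comp_add_right t
  have i12 : Integrable fun x : ℝ ↦
      (Icc (-b) b).indicator p (x + t) ^ 2 + (Icc (-b) b).indicator p x ^ 2 := i1.add i2
  have i3 : Integrable fun x : ℝ ↦
      2 * (Icc (-b) (b - t)).indicator (fun y ↦ p (y + t) * p y) x :=
    (incs_integrable_mul hp b t).const_mul 2
  rw [integral_sub i12 i3, integral_add i1 i2, integral_const_mul,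
    integral_add_right_eq_self (fun x : ℝ ↦ (Icc (-b) b).indicator p x ^ 2) t,
    incs_integral_sq p hb]
  ring

set_option linter.dupNamespace false in
/-- **Increments of a windowed profile, `0 ≤ t ≤ 2b`**:
`D_t(1_{[-b,b]} p) = ∫_{-b}^{-b+t} p² + ∫_{b-t}^{b} p² + ∫_{-b}^{b-t} (p(x+t) − p(x))²`. [folklore] -/
theorem incs_weilIncrement_of_le {p : ℝ → ℝ} (hp : Continuous p) {b t : ℝ} (hb : 0 < b)
    (ht0 : 0 ≤ t) (ht : t ≤ 2 * b) :
    weilIncrement (fun x : ℝ ↦ (((Icc (-b) b).indicator p x : ℝ) : ℂ)) t =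
      (∫ x in (-b)..(-b + t), p x ^ 2) + (∫ x in (b - t)..b, p x ^ 2) +
        ∫ x in (-b)..(b - t), (p (x + t) - p x) ^ 2 := by
  rw [incs_weilIncrement_eq hp hb ht0, incs_integral_mul_of_le p ht]
  have hc2 : Continuous fun y : ℝ ↦ p y ^ 2 := by fun_prop
  have hc1 : Continuous fun y : ℝ ↦ p (y + t) ^ 2 := by fun_prop
  have hc3 : Continuous fun y : ℝ ↦ p (y + t) * p y := by fun_prop
  have hI1 : ∫ x in (-b)..b, p x ^ 2 = (∫ x in (-b)..(-b + t), p x ^ 2) + ∫ x in (-b + t)..b, p x ^ 2 :=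
    (intervalIntegral.integral_add_adjacent_intervals (hc2.intervalIntegrable _ _)
      (hc2.intervalIntegrable _ _)).symm
  have hI2 : ∫ x in (-b)..b, p x ^ 2 = (∫ x in (-b)..(b - t), p x ^ 2) + ∫ x in (b - t)..b, p x ^ 2 :=
    (intervalIntegral.integral_add_adjacent_intervals (hc2.intervalIntegrable _ _)
      (hc2.intervalIntegrable _ _)).symm
  have hD1 : ∫ x in (-b)..(b - t), p (x + t) ^ 2 = ∫ x in (-b + t)..b, p x ^ 2 := by
    have h := intervalIntegral.integral_comp_add_right (a := -b) (b := b - t) (fun y : ℝ ↦ p y ^ 2) t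
    rwa [sub_add_cancel] at h
  have hD : ∫ x in (-b)..(b - t), (p (x + t) - p x) ^ 2 =
      (∫ x in (-b)..(b - t), p (x + t) ^ 2) - 2 * (∫ x in (-b)..(b - t), p (x + t) * p x) +
        ∫ x in (-b)..(b - t), p x ^ 2 := by
    have e : ∀ x : ℝ, (p (x + t) - p x) ^ 2 = (p (x + t) ^ 2 - 2 * (p (x + t) * p x)) + p x ^ 2 :=
      fun x ↦ by ring
    simp_rw [e]
    rw [intervalIntegral.integral_add (((hc1.intervalIntegrable _ _)).sub
        ((hc3.intervalIntegrable _ _).const_mul 2)) (hc2.intervalIntegrable _ _),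
      intervalIntegral.integral_sub (hc1.intervalIntegrable _ _)
        ((hc3.intervalIntegrable _ _).const_mul 2),
      intervalIntegral.integral_const_mul]
  linarith [hI1, hI2, hD1, hD]

set_option linter.dupNamespace false in
/-- **Increments of a windowed profile, `t ≥ 2b`**: `D_t(1_{[-b,b]} p) = 2 ∫_{-b}^{b} p²`. [folklore] -/
theorem incs_weilIncrement_of_ge {p : ℝ → ℝ} (hp : Continuous p) {b t : ℝ} (hb : 0 < b)
    (ht : 2 * b ≤ t) :
    weilIncrement (fun x : ℝ ↦ (((Icc (-b) b).indicator p x : ℝ) : ℂ)) t =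
      2 * ∫ x in (-b)..b, p x ^ 2 := by
  rw [incs_weilIncrement_eq hp hb (by linarith), incs_integral_mul_of_ge p ht, mul_zero, sub_zero]

set_option linter.dupNamespace false in
/-- `‖1_{[-b,b]} p‖₂² = ∫_{-b}^{b} p²`. [folklore] -/
theorem incs_integral_norm_sq (p : ℝ → ℝ) {b : ℝ} (hb : 0 < b) :
    ∫ x : ℝ, ‖(((Icc (-b) b).indicator p x : ℝ) : ℂ)‖ ^ 2 = ∫ x in (-b)..b, p x ^ 2 := by
  simp only [Complex.norm_real, Real.norm_eq_abs, sq_abs]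
  exact incs_integral_sq p hb

set_option linter.dupNamespace false in
/-- The windowed profile is in `L²`. [folklore] -/
theorem incs_memLp {p : ℝ → ℝ} (hp : Continuous p) (b : ℝ) :
    MemLp (fun x : ℝ ↦ (((Icc (-b) b).indicator p x : ℝ) : ℂ)) 2 volume := by
  have hm : AEStronglyMeasurable (fun x : ℝ ↦ (((Icc (-b) b).indicator p x : ℝ) : ℂ)) volume :=
    (hp.measurable.indicator measurableSet_Icc).complex_ofReal.aestronglyMeasurable
  refine (memLp_two_iff_integrable_sq_norm hm).2 ?_
  simp only [Complex.norm_real, Real.norm_eq_abs, sq_abs]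
  exact incs_integrable_sq hp b

end GroundStateSimpleEven

set_option linter.dupNamespace false in
/-- **Increments of a windowed profile (generic measure theory).** For a continuous profile `p` and
the windowed function `f = 1_{[-b,b]} · p` (real, viewed in `ℂ`):
`D_t(f) = ∫_{-b}^{-b+t} p² + ∫_{b-t}^{b} p² + ∫_{-b}^{b-t} (p(x+t) − p(x))²` for `0 ≤ t ≤ 2b`,
`D_t(f) = 2 ∫_{-b}^{b} p²` for `t ≥ 2b` (a.e.-disjoint translates), `‖f‖₂² = ∫_{-b}^{b} p²`,
`f ∈ L²`, and `f = 0` off the window. [folklore] -/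
theorem stub_incrementSplit :
    ∀ (p : ℝ → ℝ) (b : ℝ), Continuous p → 0 < b →
      (∀ t : ℝ, 0 ≤ t → t ≤ 2 * b →
        weilIncrement (fun x : ℝ ↦ (((Icc (-b) b).indicator p x : ℝ) : ℂ)) t =
          (∫ x in (-b)..(-b + t), p x ^ 2) + (∫ x in (b - t)..b, p x ^ 2) +
            ∫ x in (-b)..(b - t), (p (x + t) - p x) ^ 2) ∧
      (∀ t : ℝ, 2 * b ≤ t →
        weilIncrement (fun x : ℝ ↦ (((Icc (-b) b).indicator p x : ℝ) : ℂ)) t =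
          2 * ∫ x in (-b)..b, p x ^ 2) ∧
      (∫ x : ℝ, ‖(((Icc (-b) b).indicator p x : ℝ) : ℂ)‖ ^ 2 = ∫ x in (-b)..b, p x ^ 2) ∧
      MemLp (fun x : ℝ ↦ (((Icc (-b) b).indicator p x : ℝ) : ℂ)) 2 volume ∧
      (∀ᵐ x : ℝ, x ∉ Icc (-b) b → (((Icc (-b) b).indicator p x : ℝ) : ℂ) = 0) := by
  intro p b hp hb
  refine ⟨fun t ht0 ht ↦ GroundStateSimpleEven.incs_weilIncrement_of_le hp hb ht0 ht,
    fun t ht ↦ GroundStateSimpleEven.incs_weilIncrement_of_ge hp hb ht,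
    GroundStateSimpleEven.incs_integral_norm_sq p hb, GroundStateSimpleEven.incs_memLp hp b,
    Eventually.of_forall fun x hx ↦ ?_⟩
  rw [indicator_of_notMem hx, Complex.ofReal_zero]

end Summit.RiemannHypothesis.RiemannHypothesis.Theorems
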